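import Mathlib
import HarnessLib.Audit
import Summits.PneNP.PneNP.Theorems.PstarChordReads
import Summits.PneNP.PneNP.Theorems.PstarChordBridgeTools

/-!
# The involution on a chord private with ARBITRARY monomials: effective directions (ROUND-24, O1 at exact tightness; `TerminalPeelable`)

FRONTIER range-avoidance ladder, rung F-N3, ROUND 24 (cell `pnp-ideate`, prover-2 memo `g19/O1-CHORD-READ.md` §6.3/§6.10 (fibrewise involution);
typed target `PstarCoreBoundTargets.TerminalPeelable` (p646951); restricted-model proof complexity — nothing here bears on `P` versus `NP`).

`PstarChordReads` treats a chord private `p` read only LINEARLY.  Here the monomials of the constraints may touch `p` arbitrarily (gates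
`(p, z)` with fresh or shared partners, pendants): flipping `x_p` moves the G-constraint `(C, G)` by `(b + x_p) · coef p (x)` where
`coef p = [p ∈ C] + Σ_{g ∈ G, p ∈ g} x_{partner}` is the READ COEFFICIENT of `PstarChordBridgeTools` (`bit_gval_update_coef`).  So the involution
lemma of the memo holds FIBREWISE with the EFFECTIVE DIRECTION `(coef₁ p x, coef₂ p x)` at the point:

* `gval₂_ne_of_coef` — at a solution of the core with `x_q = 0`, `coef₁ p x = 1`, `coef₂ p x = 0`: `Γ₂` fails;  `gval₁_ne_of_coef` — mirror;
* `gval_iff_of_coef` — `coef₁ p x = coef₂ p x = 1`: exactly one of `Γ₁, Γ₂` holds.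

No Assumption A; everything is local to the chord `c` (assumption-free inputs of memo §6.10 (c)/(d)).
-/

set_option linter.dupNamespace false -- `Summit.PneNP.PneNP.…`: summit = sub-problem name (D-0017 single-conjunct layout)

open Finset Literature.Computability.Complexity
open Summit.PneNP.PneNP.Theorems.PstarFibrePolys (bit bit_injective)
open Summit.PneNP.PneNP.Theorems.PstarSALevel (varSet bdry)
open Summit.PneNP.PneNP.Theorems.PstarGapOneAll (gval)
open Summit.PneNP.PneNP.Theorems.PstarGConstraint (bit_gval)
open Summit.PneNP.PneNP.Theorems.PstarChordRepair (IsChord)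
open Summit.PneNP.PneNP.Theorems.PstarCoreBoundTargets (Terminal)
open Summit.PneNP.PneNP.Theorems.PstarChordBridgeTools (coef)
open Summit.PneNP.PneNP.Theorems.PstarChordReads (solves_update_of_chord)

namespace Summit.PneNP.PneNP.Theorems.PstarChordReadsGates

variable {n m : ℕ}

/-- `x + x = 0` in `𝔽₂`. -/
private theorem add_self_zmod2 (x : ZMod 2) : x + x = 0 := by
  revert x; decide

/-- **Flipping one variable moves a G-constraint by its read coefficient**:
`gval(x[v := b]) = gval(x) + (b + x_v) · coef v (x)` (in bits; `coef` evaluated at the old point, whose partners are unchanged). -/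
theorem bit_gval_update_coef (I : LocalMap 4 n m) (hI : I.IsPure xorAndPred) (C : Finset (Fin n)) (G : Finset (Fin m)) (x : Fin n → Bool)
    (v : Fin n) (b : Bool) :
    bit (gval I C G (Function.update x v b)) =
      bit (gval I C G x) + (bit b + bit (x v)) * coef I C G v (fun w => bit (x w)) := by
  classical
  have h23 : ∀ g : Fin m, I.vars g 2 ≠ I.vars g 3 := fun g hg => absurd (hI.2 g hg) (by decide)
  rw [bit_gval, bit_gval]
  unfold coef
  -- linear part
  have hlin : ∑ w ∈ C, bit (Function.update x v b w) = ∑ w ∈ C, bit (x w) + (bit b + bit (x v)) * (if v ∈ C then 1 else 0) := by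
    have key : ∀ w ∈ C, bit (Function.update x v b w) = bit (x w) + if w = v then bit b + bit (x v) else 0 := by
      intro w _
      by_cases h : w = v
      · subst h
        rw [Function.update_self, if_pos rfl]
        linear_combination -(add_self_zmod2 (bit (x w)))
      · rw [Function.update_of_ne h, if_neg h, add_zero]
    rw [sum_congr rfl key, sum_add_distrib, sum_ite_eq' C v]
    split_ifs <;> ring
  -- monomial part
  have hmono : ∑ g ∈ G, bit (Function.update x v b (I.vars g 2)) * bit (Function.update x v b (I.vars g 3)) =
      ∑ g ∈ G, bit (x (I.vars g 2)) * bit (x (I.vars g 3)) + (bit b + bit (x v)) *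
        ∑ g ∈ G, ((if I.vars g 2 = v then bit (x (I.vars g 3)) else 0) + (if I.vars g 3 = v then bit (x (I.vars g 2)) else 0)) := by
    rw [mul_sum, ← sum_add_distrib]
    have h2z : (2 : ZMod 2) = 0 := by decide
    refine sum_congr rfl fun g _ => ?_
    by_cases h2 : I.vars g 2 = v
    · have h3 : I.vars g 3 ≠ v := fun h => h23 g (h2.trans h.symm)
      rw [h2, Function.update_self, Function.update_of_ne h3, if_pos rfl, if_neg h3]
      linear_combination (-(bit (x (I.vars g 3)) * bit (x v))) * h2z
    · by_cases h3 : I.vars g 3 = v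
      · rw [h3, Function.update_self, Function.update_of_ne h2, if_neg h2, if_pos rfl]
        linear_combination (-(bit (x (I.vars g 2)) * bit (x v))) * h2z
      · rw [Function.update_of_ne h2, Function.update_of_ne h3, if_neg h2, if_neg h3]
        ring
  rw [hlin, hmono]
  ring

/-- Boolean form: flipping `x_v` flips `gval` iff the read coefficient of `v` at `x` is `1`. -/
theorem gval_update_not_coef (I : LocalMap 4 n m) (hI : I.IsPure xorAndPred) (C : Finset (Fin n)) (G : Finset (Fin m)) (x : Fin n → Bool)
    (v : Fin n) :
    gval I C G (Function.update x v (!x v)) =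
      (if coef I C G v (fun w => bit (x w)) = 1 then !gval I C G x else gval I C G x) := by
  have h := bit_gval_update_coef I hI C G x v (!x v)
  have hb : bit (!x v) + bit (x v) = 1 := by cases x v <;> decide
  rw [hb, one_mul] at h
  have hc : coef I C G v (fun w => bit (x w)) = 0 ∨ coef I C G v (fun w => bit (x w)) = 1 := by
    generalize coef I C G v (fun w => bit (x w)) = t; revert t; decide
  apply bit_injective
  rcases hc with hc | hc
  · rw [if_neg (by rw [hc]; decide), h, hc, add_zero]
  · rw [if_pos hc, h, hc]
    cases gval I C G x <;> decide

section Terminal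

variable {I : LocalMap 4 n m} {r : ℕ} {y : Fin m → Bool} {J₀ : Finset (Fin m)} {w₁ w₂ : Finset (Fin n) × Finset (Fin m) × Bool} {c : Fin m}

/-- (T3): no solution of the core satisfies both constraints. -/
private theorem not_both (ht : Terminal I r y J₀ w₁ w₂) {x : Fin n → Bool} (hx : ∀ j ∈ J₀, I.eval x j = y j)
    (h₁ : gval I w₁.1 w₁.2.1 x = w₁.2.2) (h₂ : gval I w₂.1 w₂.2.1 x = w₂.2.2) : False :=
  ht.2.2.2.2.2.2.1 ⟨x, hx, h₁, h₂⟩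

/-- **Fibrewise involution, effective direction `(1,0)`.**  At a solution of the core with `x_q = 0` where the read coefficient of the chord
private `p = vars c 2` is `1` in `Γ₁` and `0` in `Γ₂`, the constraint `Γ₂` FAILS. -/
theorem gval₂_ne_of_coef (hI : I.IsPure xorAndPred) (ht : Terminal I r y J₀ w₁ w₂) (hc : c ∈ J₀) (hch : IsChord I J₀ c)
    {x : Fin n → Bool} (hx : ∀ j ∈ J₀, I.eval x j = y j) (hq : x (I.vars c 3) = false)
    (h₁ : coef I w₁.1 w₁.2.1 (I.vars c 2) (fun w => bit (x w)) = 1) (h₂ : coef I w₂.1 w₂.2.1 (I.vars c 2) (fun w => bit (x w)) = 0) :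
    gval I w₂.1 w₂.2.1 x ≠ w₂.2.2 := by
  intro hg₂
  have hx' := solves_update_of_chord hI hc hch hx hq (!x (I.vars c 2))
  have e₁ := gval_update_not_coef I hI w₁.1 w₁.2.1 x (I.vars c 2)
  have e₂ := gval_update_not_coef I hI w₂.1 w₂.2.1 x (I.vars c 2)
  rw [if_pos h₁] at e₁
  rw [h₂, if_neg (by decide), hg₂] at e₂
  by_cases hg₁ : gval I w₁.1 w₁.2.1 x = w₁.2.2
  · exact not_both ht hx hg₁ hg₂
  · refine not_both ht hx' ?_ e₂
    rw [e₁]; revert hg₁; cases gval I w₁.1 w₁.2.1 x <;> cases w₁.2.2 <;> decide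

/-- **Fibrewise involution, effective direction `(0,1)`** (mirror image). -/
theorem gval₁_ne_of_coef (hI : I.IsPure xorAndPred) (ht : Terminal I r y J₀ w₁ w₂) (hc : c ∈ J₀) (hch : IsChord I J₀ c)
    {x : Fin n → Bool} (hx : ∀ j ∈ J₀, I.eval x j = y j) (hq : x (I.vars c 3) = false)
    (h₁ : coef I w₁.1 w₁.2.1 (I.vars c 2) (fun w => bit (x w)) = 0) (h₂ : coef I w₂.1 w₂.2.1 (I.vars c 2) (fun w => bit (x w)) = 1) :
    gval I w₁.1 w₁.2.1 x ≠ w₁.2.2 := by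
  intro hg₁
  have hx' := solves_update_of_chord hI hc hch hx hq (!x (I.vars c 2))
  have e₁ := gval_update_not_coef I hI w₁.1 w₁.2.1 x (I.vars c 2)
  have e₂ := gval_update_not_coef I hI w₂.1 w₂.2.1 x (I.vars c 2)
  rw [h₁, if_neg (by decide), hg₁] at e₁
  rw [if_pos h₂] at e₂
  by_cases hg₂ : gval I w₂.1 w₂.2.1 x = w₂.2.2
  · exact not_both ht hx hg₁ hg₂
  · refine not_both ht hx' e₁ ?_
    rw [e₂]; revert hg₂; cases gval I w₂.1 w₂.2.1 x <;> cases w₂.2.2 <;> decide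

/-- **Fibrewise involution, effective direction `(1,1)`**: exactly one of the two constraints holds. -/
theorem gval_iff_of_coef (hI : I.IsPure xorAndPred) (ht : Terminal I r y J₀ w₁ w₂) (hc : c ∈ J₀) (hch : IsChord I J₀ c)
    {x : Fin n → Bool} (hx : ∀ j ∈ J₀, I.eval x j = y j) (hq : x (I.vars c 3) = false)
    (h₁ : coef I w₁.1 w₁.2.1 (I.vars c 2) (fun w => bit (x w)) = 1) (h₂ : coef I w₂.1 w₂.2.1 (I.vars c 2) (fun w => bit (x w)) = 1) :
    (gval I w₁.1 w₁.2.1 x = w₁.2.2 ↔ gval I w₂.1 w₂.2.1 x ≠ w₂.2.2) := by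
  have hx' := solves_update_of_chord hI hc hch hx hq (!x (I.vars c 2))
  have e₁ := gval_update_not_coef I hI w₁.1 w₁.2.1 x (I.vars c 2)
  have e₂ := gval_update_not_coef I hI w₂.1 w₂.2.1 x (I.vars c 2)
  rw [if_pos h₁] at e₁
  rw [if_pos h₂] at e₂
  have hA := fun (a : gval I w₁.1 w₁.2.1 x = w₁.2.2) (b : gval I w₂.1 w₂.2.1 x = w₂.2.2) => not_both ht hx a b
  have hB := fun (a : gval I w₁.1 w₁.2.1 (Function.update x (I.vars c 2) (!x (I.vars c 2))) = w₁.2.2)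
    (b : gval I w₂.1 w₂.2.1 (Function.update x (I.vars c 2) (!x (I.vars c 2))) = w₂.2.2) => not_both ht hx' a b
  rw [e₁, e₂] at hB
  revert hA hB
  cases gval I w₁.1 w₁.2.1 x <;> cases w₁.2.2 <;> cases gval I w₂.1 w₂.2.1 x <;> cases w₂.2.2 <;> decide

end Terminal

end Summit.PneNP.PneNP.Theorems.PstarChordReadsGates
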